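import Summits.CriticalPhenomena.PercolationContinuityZ3.Theorems.PercFiniteBoxLRORenormaliseFromLinearLROBlockDefs

/-!
# `stub_largeCountMoments` of line `registered` (crux `PercFiniteBoxLRO.RenormaliseFromLinearLRO`,
# stmt-CriticalPhenomena-0857, reshape 2): the first two moments of the number of locally large points

Registered stub `stub_largeCountMoments` of the lead's skeleton.  For a finite set `G ⊆ ℤ³` whose points
are pairwise at sup-distance `≥ 2s+1` in some coordinate, let `X := largeCount s G` be the number of points
`y ∈ G` that are locally large at scale `s` (`ω ∈ DCT16.armEvent y s`, the translate to `y` of the one-arm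
event `{0 ⟷ ∂Λ(s)}`), and `θ_s := P_p(0 ⟷ ∂Λ(s)) = P_p(siteToBoundary 3 s)`.  Then

* `E_p[X] = #G · θ_s`: `X = Σ_{y ∈ G} 1_{A_y}` (`largeCount_eq_sum_indicator`), linearity, and translation
  invariance `P_p(A_y) = θ_s` (`DCT16.real_armEvent`);
* `E_p[X²] ≤ #G · θ_s + (#G)² · θ_s²`: `X² = Σ_{y, y' ∈ G} 1_{A_y ∩ A_{y'}}`; a diagonal term has
  probability `θ_s`, and for `y ≠ y'` the events `A_y`, `A_{y'}` are determined by the pairs inside the boxes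
  `y + Λ(s)`, `y' + Λ(s)` (`determinedBy_armEvent`), which are DISJOINT sets of pairs (a common pair would
  have a vertex `a` with `|a_i - y_i| ≤ s` and `|a_i - y'_i| ≤ s` for all `i`, so `|y_i - y'_i| ≤ 2s`),
  hence independent under the product measure (`bondPercolation_real_inter_of_disjoint`): probability
  `θ_s²`; there are at most `(#G)²` such terms.

Sources: G. Grimmett, *Percolation*, 2nd ed. (1999), §1.6 (translation invariance) and §2.2–§2.3
(events on disjoint edge sets are independent); the moment computation itself is elementary
(second-moment method).
-/

noncomputable section

namespace Summit.CriticalPhenomena.PercolationContinuityZ3.Theorems.RenormaliseFromLinearLRO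

open Literature.Probability.Percolation Literature.Probability.LatticeModels
open MeasureTheory

/-! ## One- and two-point functions of the translated arm events -/

/-- `E_p[1_{A_y}] = θ_s`: the integral of the indicator of the translated arm event is the one-arm
probability (translation invariance, `DCT16.real_armEvent`). -/
theorem integral_indicator_armEvent (p : unitInterval) (y : Site 3) (s : ℕ) :
    ∫ ω, (DCT16.armEvent y s).indicator (fun _ => (1 : ℝ)) ω ∂(bondPercolation (zdGraph 3) p) =
      (bondPercolation (zdGraph 3) p).real (siteToBoundary 3 s) := by
  rw [integral_indicator_const (1 : ℝ) (measurableSet_armEvent y s), smul_eq_mul, mul_one,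
    DCT16.real_armEvent]

/-- The indicator of the intersection of two translated arm events is integrable. -/
theorem integrable_indicator_armEvent_inter (p : unitInterval) (y y' : Site 3) (s : ℕ) :
    Integrable (fun ω => (DCT16.armEvent y s ∩ DCT16.armEvent y' s).indicator (fun _ => (1 : ℝ)) ω)
      (bondPercolation (zdGraph 3) p) :=
  (integrable_const (1 : ℝ)).indicator ((measurableSet_armEvent y s).inter (measurableSet_armEvent y' s))

/-- The boxes `y + Λ(s)` and `y' + Λ(s)` of two points at distance `≥ 2s+1` in some coordinate use
disjoint sets of pairs. -/
theorem armEvent_disjoint_sym2 {s : ℕ} {y y' : Site 3}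
    (h : ∃ i : Fin 3, ((2 * s + 1 : ℕ) : ℤ) ≤ |y i - y' i|) :
    Disjoint ({z : Site 3 | z - y ∈ box 3 s}.sym2) ({z : Site 3 | z - y' ∈ box 3 s}.sym2) := by
  obtain ⟨i, hi⟩ := h
  rw [Set.disjoint_left]
  intro e he he'
  induction e using Sym2.ind with
  | h a b =>
    rw [Set.mk_mem_sym2_iff] at he he'
    have h1 := (mem_box.1 he.1) i
    have h2 := (mem_box.1 he'.1) i
    simp only [Pi.sub_apply] at h1 h2
    push_cast at hi h1 h2
    rcases le_abs.1 hi with h3 | h3 <;> omega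

/-- **Two-point function off the diagonal**: far-apart translated arm events are independent,
`P_p(A_y ∩ A_{y'}) = θ_s²` (disjoint sets of determining pairs, `bondPercolation_real_inter_of_disjoint`,
and translation invariance). -/
theorem armEvent_real_inter (p : unitInterval) {s : ℕ} {y y' : Site 3}
    (h : ∃ i : Fin 3, ((2 * s + 1 : ℕ) : ℤ) ≤ |y i - y' i|) :
    (bondPercolation (zdGraph 3) p).real (DCT16.armEvent y s ∩ DCT16.armEvent y' s) =
      (bondPercolation (zdGraph 3) p).real (siteToBoundary 3 s) ^ 2 := by
  rw [bondPercolation_real_inter_of_disjoint (zdGraph 3) p (armEvent_disjoint_sym2 h)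
      (determinedBy_armEvent y s Set.Subset.rfl) (determinedBy_armEvent y' s Set.Subset.rfl)
      (measurableSet_armEvent y s) (measurableSet_armEvent y' s),
    DCT16.real_armEvent, DCT16.real_armEvent, sq]

/-- Each term of the double sum: `P_p(A_y ∩ A_{y'}) ≤ [y = y'] θ_s + θ_s²`. -/
theorem armEvent_real_inter_le (p : unitInterval) {s : ℕ} {y y' : Site 3}
    (h : y ≠ y' → ∃ i : Fin 3, ((2 * s + 1 : ℕ) : ℤ) ≤ |y i - y' i|) :
    (bondPercolation (zdGraph 3) p).real (DCT16.armEvent y s ∩ DCT16.armEvent y' s) ≤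
      (if y = y' then (bondPercolation (zdGraph 3) p).real (siteToBoundary 3 s) else 0) +
        (bondPercolation (zdGraph 3) p).real (siteToBoundary 3 s) ^ 2 := by
  by_cases hyy : y = y'
  · subst hyy
    rw [if_pos rfl, Set.inter_self, DCT16.real_armEvent]
    exact le_add_of_nonneg_right (sq_nonneg _)
  · rw [if_neg hyy, armEvent_real_inter p (h hyy), zero_add]

/-! ## The square of the count as a double sum of indicators -/

/-- Product of two `{0,1}`-indicators is the indicator of the intersection. -/
theorem largeCount_indicator_mul_indicator {α : Type*} (A B : Set α) (x : α) :
    A.indicator (fun _ => (1 : ℝ)) x * B.indicator (fun _ => (1 : ℝ)) x =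
      (A ∩ B).indicator (fun _ => (1 : ℝ)) x := by
  classical
  simp only [Set.indicator_apply, Set.mem_inter_iff]
  by_cases hA : x ∈ A <;> by_cases hB : x ∈ B <;> simp [hA, hB]

/-- `X² = Σ_{y, y' ∈ G} 1_{A_y ∩ A_{y'}}` pointwise. -/
theorem largeCount_sq_eq_sum_indicator (s : ℕ) (G : Finset (Site 3)) (ω : BondConfig (Site 3)) :
    (largeCount s G ω : ℝ) ^ 2 =
      ∑ y ∈ G, ∑ y' ∈ G, (DCT16.armEvent y s ∩ DCT16.armEvent y' s).indicator (fun _ => (1 : ℝ)) ω := by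
  rw [largeCount_eq_sum_indicator, sq, Finset.sum_mul_sum]
  refine Finset.sum_congr rfl fun y _ => Finset.sum_congr rfl fun y' _ => ?_
  exact largeCount_indicator_mul_indicator _ _ ω

/-! ## The two moments -/

/-- **First moment**: `E_p[X] = #G · θ_s`. -/
theorem largeCount_integral_eq (p : unitInterval) (s : ℕ) (G : Finset (Site 3)) :
    ∫ ω, (largeCount s G ω : ℝ) ∂(bondPercolation (zdGraph 3) p) =
      G.card * (bondPercolation (zdGraph 3) p).real (siteToBoundary 3 s) := by
  calc ∫ ω, (largeCount s G ω : ℝ) ∂(bondPercolation (zdGraph 3) p)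
      = ∫ ω, ∑ y ∈ G, (DCT16.armEvent y s).indicator (fun _ => (1 : ℝ)) ω
          ∂(bondPercolation (zdGraph 3) p) := by
        simp_rw [largeCount_eq_sum_indicator]
    _ = ∑ y ∈ G, ∫ ω, (DCT16.armEvent y s).indicator (fun _ => (1 : ℝ)) ω
          ∂(bondPercolation (zdGraph 3) p) :=
        integral_finsetSum _ fun y _ => (integrable_const (1 : ℝ)).indicator (measurableSet_armEvent y s)
    _ = ∑ y ∈ G, (bondPercolation (zdGraph 3) p).real (siteToBoundary 3 s) :=
        Finset.sum_congr rfl fun y _ => integral_indicator_armEvent p y s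
    _ = G.card * (bondPercolation (zdGraph 3) p).real (siteToBoundary 3 s) := by
        rw [Finset.sum_const, nsmul_eq_mul]

/-- **Second moment**: `E_p[X²] ≤ #G · θ_s + (#G)² · θ_s²` for a `(2s+1)`-separated set `G`. -/
theorem largeCount_sq_integral_le (p : unitInterval) (s : ℕ) (G : Finset (Site 3))
    (hG : ∀ y ∈ G, ∀ y' ∈ G, y ≠ y' → ∃ i : Fin 3, ((2 * s + 1 : ℕ) : ℤ) ≤ |y i - y' i|) :
    ∫ ω, (largeCount s G ω : ℝ) ^ 2 ∂(bondPercolation (zdGraph 3) p) ≤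
      G.card * (bondPercolation (zdGraph 3) p).real (siteToBoundary 3 s) +
        (G.card : ℝ) ^ 2 * (bondPercolation (zdGraph 3) p).real (siteToBoundary 3 s) ^ 2 := by
  have inner : ∀ y ∈ G,
      ∑ y' ∈ G, ((if y = y' then (bondPercolation (zdGraph 3) p).real (siteToBoundary 3 s) else 0) +
          (bondPercolation (zdGraph 3) p).real (siteToBoundary 3 s) ^ 2) =
        (bondPercolation (zdGraph 3) p).real (siteToBoundary 3 s) +
          G.card * (bondPercolation (zdGraph 3) p).real (siteToBoundary 3 s) ^ 2 := by
    intro y hy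
    rw [Finset.sum_add_distrib, Finset.sum_ite_eq, if_pos hy, Finset.sum_const, nsmul_eq_mul]
  calc ∫ ω, (largeCount s G ω : ℝ) ^ 2 ∂(bondPercolation (zdGraph 3) p)
      = ∫ ω, ∑ y ∈ G, ∑ y' ∈ G,
          (DCT16.armEvent y s ∩ DCT16.armEvent y' s).indicator (fun _ => (1 : ℝ)) ω
            ∂(bondPercolation (zdGraph 3) p) := by
        simp_rw [largeCount_sq_eq_sum_indicator]
    _ = ∑ y ∈ G, ∫ ω, ∑ y' ∈ G,
          (DCT16.armEvent y s ∩ DCT16.armEvent y' s).indicator (fun _ => (1 : ℝ)) ω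
            ∂(bondPercolation (zdGraph 3) p) :=
        integral_finsetSum _ fun y _ =>
          integrable_finsetSum _ fun y' _ => integrable_indicator_armEvent_inter p y y' s
    _ = ∑ y ∈ G, ∑ y' ∈ G,
          ∫ ω, (DCT16.armEvent y s ∩ DCT16.armEvent y' s).indicator (fun _ => (1 : ℝ)) ω
            ∂(bondPercolation (zdGraph 3) p) :=
        Finset.sum_congr rfl fun y _ =>
          integral_finsetSum _ fun y' _ => integrable_indicator_armEvent_inter p y y' s
    _ = ∑ y ∈ G, ∑ y' ∈ G,
          (bondPercolation (zdGraph 3) p).real (DCT16.armEvent y s ∩ DCT16.armEvent y' s) := by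
        refine Finset.sum_congr rfl fun y _ => Finset.sum_congr rfl fun y' _ => ?_
        rw [integral_indicator_const (1 : ℝ)
            ((measurableSet_armEvent y s).inter (measurableSet_armEvent y' s)), smul_eq_mul, mul_one]
    _ ≤ ∑ y ∈ G, ∑ y' ∈ G,
          ((if y = y' then (bondPercolation (zdGraph 3) p).real (siteToBoundary 3 s) else 0) +
            (bondPercolation (zdGraph 3) p).real (siteToBoundary 3 s) ^ 2) :=
        Finset.sum_le_sum fun y hy => Finset.sum_le_sum fun y' hy' =>
          armEvent_real_inter_le p (hG y hy y' hy')
    _ = ∑ y ∈ G, ((bondPercolation (zdGraph 3) p).real (siteToBoundary 3 s) +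
          G.card * (bondPercolation (zdGraph 3) p).real (siteToBoundary 3 s) ^ 2) :=
        Finset.sum_congr rfl inner
    _ = G.card * (bondPercolation (zdGraph 3) p).real (siteToBoundary 3 s) +
          (G.card : ℝ) ^ 2 * (bondPercolation (zdGraph 3) p).real (siteToBoundary 3 s) ^ 2 := by
        rw [Finset.sum_const, nsmul_eq_mul]
        ring

/-- **Registered stub `stub_largeCountMoments` of crux stmt-CriticalPhenomena-0857 (line `registered`,
reshape 2)**: the first two moments of the number `X = largeCount s G` of locally large points of a
`(2s+1)`-separated finite set `G ⊆ ℤ³` under `P_p`, with `θ_s = P_p(0 ⟷ ∂Λ(s))`: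
`E_p[X] = #G · θ_s` and `E_p[X²] ≤ #G · θ_s + (#G)² · θ_s²` (diagonal terms `θ_s`; off-diagonal
terms `θ_s²` by independence of arm events with disjoint boxes). -/
theorem stub_largeCountMoments :
    ∀ (p : unitInterval) (s : ℕ) (G : Finset (Site 3)),
      (∀ y ∈ G, ∀ y' ∈ G, y ≠ y' → ∃ i : Fin 3, ((2 * s + 1 : ℕ) : ℤ) ≤ |y i - y' i|) →
      (∫ ω, (largeCount s G ω : ℝ) ∂(bondPercolation (zdGraph 3) p) =
          G.card * (bondPercolation (zdGraph 3) p).real (siteToBoundary 3 s)) ∧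
      (∫ ω, (largeCount s G ω : ℝ) ^ 2 ∂(bondPercolation (zdGraph 3) p) ≤
          G.card * (bondPercolation (zdGraph 3) p).real (siteToBoundary 3 s) +
            (G.card : ℝ) ^ 2 * (bondPercolation (zdGraph 3) p).real (siteToBoundary 3 s) ^ 2) :=
  fun p s G hG => ⟨largeCount_integral_eq p s G, largeCount_sq_integral_le p s G hG⟩

end Summit.CriticalPhenomena.PercolationContinuityZ3.Theorems.RenormaliseFromLinearLRO

end
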